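import Summits.NavierStokesRegularity.FunctionalMining.NoGo.PalinstrophySupRate
import Summits.NavierStokesRegularity.FunctionalMining.PalinstrophyRefutation
import Summits.NavierStokesRegularity.FunctionalMining.NoGo.LogDoorSecondVariation
import Summits.NavierStokesRegularity.FunctionalMining.NoGo.LogDoorVorticity
import Summits.NavierStokesRegularity.FunctionalMining.NoGo.LogDoorExpansion
import HarnessLib

/-!
# NO-GO N6, witness file: profiles, supports, planting of one field, vorticity of `G_n ± W_K`

Search for candidate a priori estimates; no regularity claim. NS FUNCTIONAL MINING — NO-GO BRANCH
(cell `pub-nsfunc`, prove seat gen 3; statement and paper-level proof by the no-go seat,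
`NoGo/PalinstrophySupRate.lean`, `pub-nsfunc-nogo/LOGDOOR.md` §1).

This file prepares the assembly of `NoGo/PalinstrophySupRateRefutation.lean` (the theorem
`palinstrophySupRateFails_fin3 : PalinstrophySupRateFails (d := Fin 3)`): the concrete profiles
`etaZ = bumpA(2·)`, `bumpR r = bumpA(·/r)`, `prof r K = (bumpR r, gK (bumpR r) K, etaZ)`, the supports
of packet and background (inside `B̄(0,2)`), the static bound pulled back to one Euclidean field
(`neg_production2_le`: plant `8·U(8(·−q))`, periodise, read off production `8⁵`, palinstrophy `8³`,
vorticity `8²`), and Step 1 of the refutation, the uniform vorticity bound of `G_n ± W_K`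
(`witness_vorticity`). Overall plan: on `ℝ³` take the bounded-vorticity background
`G_n` (`NoGo/LogDoorBackgroundField`, vorticity `≤ M₀` uniformly in `n`, equal to the linear strain
`E = n η(z)(x,−y,0)` on its core) and the shear packet `W_K` (`NoGo/LogDoorPacket`, profiles
`a = bumpA(·/r)`, `g_K = a cos(K·)/K²`, `η = bumpA(2·)`) inside the core. Planting `G_n ± W_K` on `T³`
(`QuadraticBudgetPlanting`, `torusVorticitySqAt_periodize`) and adding the two instances of the bound
isolates the second variation (`production2_add_add_sub`), which by locality and
`integral_qint` equals `n ∫η³ (Sq a 3 Sq g 0 + Sq a 2 Sq g 1 − Sq a 1 Sq g 2 − Sq a 0 Sq g 3)`, while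
`∫‖Δ(G±W)‖²` sums to `2∫‖ΔG‖² + 2∫‖ΔW_K‖²` with `∫‖ΔW_K‖² = ∫η² · Sq a 0 · Sq g_K 3 + O(1)`. With
`n ∫η³ > C M ∫η²` fixed first and then `K → ∞` (`Sq g_K 3 → ∞`, `Sq g_K l` bounded for `l ≤ 2`,
`NoGo/LogDoorOscillation`) the bound is violated. Nothing here is a statement about solutions of
Navier–Stokes beyond the instantaneous identity; it is a negative result about one candidate inequality.
-/

noncomputable section

open MeasureTheory Set Function Filter Real
open scoped ContDiff Topology Laplacian InnerProductSpace RealInnerProductSpace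

namespace Summit.NavierStokesRegularity.FunctionalMining

open Literature.Analysis.FunctionSpaces Literature.Analysis.FluidPDE Sep3

/-- `∞ ≠ 0` in `WithTop ℕ∞`. [folklore] -/
private theorem infty_ne_zero₈ : (∞ : WithTop ℕ∞) ≠ 0 := by simp

namespace LogDoor

/-! ## The profiles -/

/-- The `z`-profile `η(t) = bumpA(2t)` (`= 1` on `[-½, ½]`, `= 0` off `(-1, 1)`). [folklore] -/
def etaZ (t : ℝ) : ℝ := bumpA (2 * t)

/-- `η` is smooth. [folklore] -/
theorem etaZ_contDiff : ContDiff ℝ ∞ etaZ := bumpA.contDiff.comp (contDiff_const.mul contDiff_id)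

/-- `η t = 0` for `1 < |t|` (hence for `2 < |t|`). [folklore] -/
theorem etaZ_eq_zero {t : ℝ} (ht : 1 < |t|) : etaZ t = 0 :=
  bumpA.zero _ (by rw [abs_mul, abs_two]; linarith)

/-- `η t = 0` for `2 < |t|`. [folklore] -/
theorem etaZ_zero (t : ℝ) (ht : 2 < |t|) : etaZ t = 0 := etaZ_eq_zero (by linarith)

/-- `|η| ≤ 1`, `η(0) = 1`, `0 ≤ η`. [folklore] -/
theorem etaZ_facts (t : ℝ) : |etaZ t| ≤ 1 ∧ 0 ≤ etaZ t ∧ etaZ 0 = 1 :=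
  ⟨by unfold etaZ; rw [abs_of_nonneg (bumpA.nonneg _)]; exact bumpA.le_one _, bumpA.nonneg _,
    by simp [etaZ, bumpA.eq_one]⟩

/-- The horizontal profile `a_r(t) = bumpA(t/r)` (`= 1` on `[-r, r]`, `= 0` off `(-2r, 2r)`).
[folklore] -/
def bumpR (r t : ℝ) : ℝ := bumpA (t / r)

/-- `a_r` is smooth. [folklore] -/
theorem bumpR_contDiff (r : ℝ) : ContDiff ℝ ∞ (bumpR r) := bumpA.contDiff.comp (contDiff_id.div_const r)

/-- `a_r t = 0` for `2r < |t|` (`r > 0`). [folklore] -/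
theorem bumpR_eq_zero {r t : ℝ} (hr : 0 < r) (ht : 2 * r < |t|) : bumpR r t = 0 :=
  bumpA.zero _ (by rw [abs_div, abs_of_pos hr, lt_div_iff₀ hr]; linarith)

/-- `a_r t = 1` for `|t| ≤ r` (`r > 0`). [folklore] -/
theorem bumpR_eq_one {r t : ℝ} (hr : 0 < r) (ht : |t| ≤ r) : bumpR r t = 1 :=
  bumpA.eq_one (by rw [abs_div, abs_of_pos hr, div_le_iff₀ hr]; linarith)

/-- `|a_r| ≤ 1`. [folklore] -/
theorem abs_bumpR_le (r t : ℝ) : |bumpR r t| ≤ 1 := by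
  rw [bumpR, abs_of_nonneg (bumpA.nonneg _)]; exact bumpA.le_one _

/-- The packet profiles `(a_r, g_K = a_r cos(K·)/K², η)`. [folklore] -/
def prof (r K : ℝ) : Fin 3 → ℝ → ℝ := ![bumpR r, gK (bumpR r) K, etaZ]

/-- Profile `0`. [folklore] -/
@[simp] theorem prof_zero (r K : ℝ) : prof r K 0 = bumpR r := rfl
/-- Profile `1`. [folklore] -/
@[simp] theorem prof_one (r K : ℝ) : prof r K 1 = gK (bumpR r) K := rfl
/-- Profile `2`. [folklore] -/
@[simp] theorem prof_two (r K : ℝ) : prof r K 2 = etaZ := rfl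

/-- The profiles are smooth. [folklore] -/
theorem prof_contDiff (r K : ℝ) : ∀ i, ContDiff ℝ ∞ (prof r K i) := by
  intro i
  obtain rfl | rfl | rfl : i = 0 ∨ i = 1 ∨ i = 2 := by fin_cases i <;> simp
  · exact bumpR_contDiff r
  · exact contDiff_gK (bumpR_contDiff r) K
  · exact etaZ_contDiff

/-- The profiles vanish off `[-2, 2]` when `0 < r ≤ 1`. [folklore] -/
theorem prof_eq_zero {r : ℝ} (hr : 0 < r) (hr1 : r ≤ 1) (K : ℝ) :
    ∀ i t, 2 < |t| → prof r K i t = 0 := by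
  intro i t ht
  obtain rfl | rfl | rfl : i = 0 ∨ i = 1 ∨ i = 2 := by fin_cases i <;> simp
  · exact bumpR_eq_zero hr (by linarith)
  · show gK (bumpR r) K t = 0
    simp [gK, bumpR_eq_zero hr (by linarith : 2 * r < |t|)]
  · exact etaZ_zero t ht

/-! ## Supports -/

/-- The packet vanishes outside the box `|y₀| ≤ 2r`, `|y₁| ≤ 2r`, `|y₂| ≤ 1`. [folklore] -/
theorem packet_eq_zero_of_box {r : ℝ} (hr : 0 < r) (K : ℝ) {y : E3}
    (hy : 2 * r < |y 0| ∨ 2 * r < |y 1| ∨ 1 < |y 2|) : packet (prof r K) y = 0 := by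
  have ha : ∀ t, 2 * r < |t| → bumpR r t = 0 := fun t ht => bumpR_eq_zero hr ht
  have hg : ∀ t, 2 * r < |t| → gK (bumpR r) K t = 0 := fun t ht => by simp [gK, ha t ht]
  have he : ∀ t, 1 < |t| → etaZ t = 0 := fun t ht => etaZ_eq_zero ht
  ext i
  obtain rfl | rfl | rfl : i = 0 ∨ i = 1 ∨ i = 2 := by fin_cases i <;> simp
  · rw [packet_apply, UW_zero_apply]
    simp only [sep, prof_zero, prof_one, prof_two, PiLp.zero_apply]
    rcases hy with h | h | h
    · rw [iteratedDeriv_eq_zero_of_abs_lt ha 0 _ h]; ring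
    · rw [iteratedDeriv_eq_zero_of_abs_lt hg 1 _ h]; ring
    · rw [iteratedDeriv_eq_zero_of_abs_lt he 0 _ h]; ring
  · rw [packet_apply, UW_one_apply]
    simp only [sep, prof_zero, prof_one, prof_two, PiLp.zero_apply]
    rcases hy with h | h | h
    · rw [iteratedDeriv_eq_zero_of_abs_lt ha 1 _ h]; ring
    · rw [iteratedDeriv_eq_zero_of_abs_lt hg 0 _ h]; ring
    · rw [iteratedDeriv_eq_zero_of_abs_lt he 0 _ h]; ring
  · rw [packet_apply, UW_two_apply]; rfl

/-- The packet vanishes near every point outside its box. [folklore] -/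
theorem packet_eventuallyEq_zero {r : ℝ} (hr : 0 < r) (K : ℝ) {y : E3}
    (hy : 2 * r < |y 0| ∨ 2 * r < |y 1| ∨ 1 < |y 2|) :
    packet (prof r K) =ᶠ[𝓝 y] fun _ => 0 := by
  have hopen : IsOpen {z : E3 | 2 * r < |z 0| ∨ 2 * r < |z 1| ∨ 1 < |z 2|} := by
    have hc : ∀ i : Fin 3, Continuous fun z : E3 => |z i| := fun i =>
      continuous_abs.comp (EuclideanSpace.proj i).continuous
    simp only [setOf_or]
    exact (isOpen_lt continuous_const (hc 0)).union
      ((isOpen_lt continuous_const (hc 1)).union (isOpen_lt continuous_const (hc 2)))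
  exact eventuallyEq_of_mem (hopen.mem_nhds hy) fun z hz => packet_eq_zero_of_box hr K hz

/-- The background vanishes outside `Q ≤ 1`, `|y₂| ≤ 1`. [folklore] -/
theorem background_eq_zero_of_box (n : ℕ) {y : E3} (hy : 1 < Qr y ∨ 1 < |y 2|) :
    background n etaZ y = 0 := by
  ext i
  rw [background, vec3_apply, PiLp.zero_apply]
  rcases hy with h | h
  · exact UG_eq_zero_of_one_lt h i
  · exact UG_eq_zero_of_eta (etaZ_eq_zero h) i

/-- Supports: for `0 < r ≤ 1/4`, both the packet and the background are supported in the closed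
ball of radius `2`, and so is `G ± W`. [folklore] -/
theorem tsupport_subset {r : ℝ} (hr : 0 < r) (hr4 : r ≤ 1 / 4) (K : ℝ) (n : ℕ) (t s : ℝ) :
    tsupport (fun y => t • background n etaZ y + s • packet (prof r K) y) ⊆ Metric.closedBall 0 2 := by
  refine closure_minimal (fun y hy => ?_) Metric.isClosed_closedBall
  rw [Metric.mem_closedBall, dist_zero_right]
  by_contra hnorm
  push Not at hnorm
  have hsq : 4 < ‖y‖ ^ 2 := by nlinarith [norm_nonneg y]
  rw [EuclideanSpace.norm_sq_eq, Fin.sum_univ_three] at hsq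
  simp only [Real.norm_eq_abs, sq_abs] at hsq
  apply hy
  -- either `|y₂| > 1`, or `Q > 1` and one of `|y₀|, |y₁| > 2r`
  by_cases h2 : 1 < |y 2|
  · simp [background_eq_zero_of_box n (Or.inr h2), packet_eq_zero_of_box hr K (Or.inr (Or.inr h2))]
  · push Not at h2
    have hy2 : y 2 ^ 2 ≤ 1 := by rw [← sq_abs]; nlinarith [abs_nonneg (y 2)]
    have hQ : 1 < Qr y := by unfold Qr; linarith
    have hbox : 2 * r < |y 0| ∨ 2 * r < |y 1| ∨ 1 < |y 2| := by
      by_contra hc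
      rw [not_or, not_or, not_lt, not_lt] at hc
      have h0 : y 0 ^ 2 ≤ (2 * r) ^ 2 := by rw [← sq_abs]; nlinarith [abs_nonneg (y 0), hc.1]
      have h1 : y 1 ^ 2 ≤ (2 * r) ^ 2 := by rw [← sq_abs]; nlinarith [abs_nonneg (y 1), hc.2.1]
      unfold Qr at hQ
      nlinarith
    simp [background_eq_zero_of_box n (Or.inl hQ), packet_eq_zero_of_box hr K hbox]

/-! ## Planting one field: the static bound pulled back to `ℝ³` -/

/-- **The static bound, pulled back to `ℝ³`.** If `PalinstrophySupRateBound C` holds on `T³`, then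
for every smooth divergence-free `U` on `ℝ³` supported in `B̄(0,2)` with Euclidean vorticity
`eVortSq U ≤ M²` pointwise: `−∫⟪DU(U), Δ²U⟫ ≤ C · M · ∫‖ΔU‖²` (plant `8·U(8(·−q))` in the unit cube
and periodise; production scales by `8⁵`, palinstrophy by `8³`, vorticity by `8²`). [folklore] -/
theorem neg_production2_le {C M : ℝ} (hC : PalinstrophySupRateBound (d := Fin 3) C) (hM : 0 ≤ M)
    {U : E3 → E3} (hU : ContDiff ℝ ∞ U) (hUs : tsupport U ⊆ Metric.closedBall 0 2)
    (hdiv : ∀ y, LinearMap.trace ℝ E3 (fderiv ℝ U y : E3 →ₗ[ℝ] E3) = 0)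
    (hvort : ∀ y, eVortSq U y ≤ M ^ 2) :
    -(∫ y, ⟪fderiv ℝ U y (U y), Δ (Δ U) y⟫) ≤ C * M * ∫ y, ‖Δ U y‖ ^ 2 := by
  obtain ⟨q, hq⟩ : ∃ q : E3, ∀ i, q i = 1 / 2 := ⟨WithLp.toLp 2 fun _ => 1 / 2, fun _ => rfl⟩
  have hc8 : (8 : ℝ) ≤ 8 := le_rfl
  have hdiv' : ∀ y, VectorCalculus.divergence U y = 0 := hdiv
  obtain ⟨hsm, hdf, -, -, -, hDn⟩ := planted_facts hU hUs hdiv' hq hc8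
  obtain ⟨hσn, -⟩ := planted_facts2 hU hUs hq hc8
  have hg : ContDiff ℝ ∞ (fun y => (8 : ℝ) • U ((8 : ℝ) • (y + -q))) := contDiff_plant hU 8 (-q)
  have hgs : tsupport (fun y => (8 : ℝ) • U ((8 : ℝ) • (y + -q))) ⊆ {y | ∀ i, y i ∈ Ioo (0 : ℝ) 1} := by
    intro y hy
    have h1 := tsupport_plant (by norm_num : (0 : ℝ) < 8) hUs (-q) hy
    rw [neg_neg, Metric.mem_closedBall, dist_eq_norm] at h1
    have h2 : ‖y - q‖ < 1 / 2 := by linarith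
    simpa using (Torus.add_mem_unitCube_of_norm_lt hq h2).2
  have hω : ∀ x, torusVorticitySqAt (Torus.periodize fun y => (8 : ℝ) • U ((8 : ℝ) • (y + -q))) x ≤
      (64 * M) ^ 2 := fun x => by
    rw [torusVorticitySqAt_periodize hg hgs, eVortSq_plant U (by norm_num) (-q)]
    have := hvort ((8 : ℝ) • (Torus.repr x + -q))
    nlinarith
  have h := hC (Fintype.card_fin 3) _ hsm hdf (64 * M) (by positivity) hω
  simp only [torusPalinstrophy] at h
  rw [hDn, hσn] at h
  have e : C * (64 * M) * ((8 : ℝ) ^ 3 * ∫ z, ‖Δ U z‖ ^ 2) = 8 ^ 5 * (C * M * ∫ z, ‖Δ U z‖ ^ 2) := by ring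
  rw [e, ← mul_neg] at h
  exact le_of_mul_le_mul_left h (by norm_num)

/-! ## The three steps of the refutation -/

/-- **Step 1 (vorticity of the witness, uniform in `n`).** With `B₁, B₂` bounds for `|β'|, |β''|`,
`E₁` for `|η'|`, `A₁, A₂` for `|a_r'|, |a_r''|`, and `K ≥ 1 + 2A₁ + 2A₂ + (A₁+1)E₁ + A₁E₁`, the
Euclidean vorticity of `G_n ± W_K` is at most
`M² := ((24B₁+32B₂) + 2)² + 2((2+8B₁)E₁ + 1)²` — independent of `n` and `K`. [folklore] -/
theorem witness_vorticity (n : ℕ) {r K B₁ B₂ E₁ A₁ A₂ : ℝ} (hB₁ : 0 ≤ B₁) (hB₂ : 0 ≤ B₂)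
    (hb1 : ∀ s, |iteratedDeriv 1 stepB s| ≤ B₁) (hb2 : ∀ s, |iteratedDeriv 2 stepB s| ≤ B₂)
    (hE1 : ∀ t, |iteratedDeriv 1 etaZ t| ≤ E₁) (hA₂ : 0 ≤ A₂)
    (hA1 : ∀ t, |iteratedDeriv 1 (bumpR r) t| ≤ A₁) (hA2 : ∀ t, |iteratedDeriv 2 (bumpR r) t| ≤ A₂)
    (hK1 : 1 ≤ K) (hKK : 1 + 2 * A₁ + 2 * A₂ + (A₁ + 1) * E₁ + A₁ * E₁ ≤ K) (y : E3) :
    eVortSq (fun z => background n etaZ z + packet (prof r K) z) y ≤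
        ((24 * B₁ + 32 * B₂) * 1 + 2) ^ 2 + ((2 + 8 * B₁) * E₁ + 1) ^ 2 + ((2 + 8 * B₁) * E₁ + 1) ^ 2 ∧
      eVortSq (fun z => background n etaZ z - packet (prof r K) z) y ≤
        ((24 * B₁ + 32 * B₂) * 1 + 2) ^ 2 + ((2 + 8 * B₁) * E₁ + 1) ^ 2 + ((2 + 8 * B₁) * E₁ + 1) ^ 2 := by
  have hK0 : 0 < K := by linarith
  have hA₁ : 0 ≤ A₁ := (abs_nonneg _).trans (hA1 0)
  have hE₁ : 0 ≤ E₁ := (abs_nonneg _).trans (hE1 0)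
  have hE0 : ∀ t, |etaZ t| ≤ 1 := fun t => (etaZ_facts t).1
  have hE0i : ∀ t, |iteratedDeriv 0 etaZ t| ≤ 1 := fun t => by rw [iteratedDeriv_zero]; exact hE0 t
  have hE1' : ∀ t, |deriv etaZ t| ≤ E₁ := fun t => by rw [← iteratedDeriv_one]; exact hE1 t
  have ha : ContDiff ℝ ∞ (bumpR r) := bumpR_contDiff r
  have hA0 : ∀ t, |iteratedDeriv 0 (bumpR r) t| ≤ 1 := fun t => by
    rw [iteratedDeriv_zero]; exact abs_bumpR_le r t
  have hφ : ∀ i, ContDiff ℝ ∞ (prof r K i) := prof_contDiff r K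
  obtain ⟨g01, g02, g12⟩ := abs_background_entries_le (n := n) etaZ_contDiff hB₁ hB₂ hb1 hb2 hE0 hE1' y
  have Γ0 : ∀ t, |iteratedDeriv 0 (gK (bumpR r) K) t| ≤ 1 / K ^ 2 := fun t =>
    (abs_gK_bounds ha hK1 hA0 hA1 hA2 t).1
  have Γ1 : ∀ t, |iteratedDeriv 1 (gK (bumpR r) K) t| ≤ (A₁ + 1) / K := fun t =>
    (abs_gK_bounds ha hK1 hA0 hA1 hA2 t).2.1
  have Γ2 : ∀ t, |iteratedDeriv 2 (gK (bumpR r) K) t| ≤ 1 + (2 * A₁ + A₂) / K := fun t =>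
    (abs_gK_bounds ha hK1 hA0 hA1 hA2 t).2.2
  obtain ⟨w01, w02, w12⟩ := abs_packet_entries_le hφ hA0 hA1 hA2 Γ0 Γ1 Γ2 hE0i hE1 y
  have hK2 : K ≤ K ^ 2 := by nlinarith
  have i1 : A₂ * (1 / K ^ 2) ≤ A₂ / K := by
    rw [mul_one_div]; exact div_le_div_of_nonneg_left hA₂ hK0 hK2
  have i2 : A₂ / K + (2 * A₁ + A₂) / K ≤ 1 := by
    rw [← add_div, div_le_one hK0]; nlinarith
  have i3 : 1 * ((A₁ + 1) / K) * E₁ ≤ 1 := by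
    rw [one_mul, div_mul_eq_mul_div, div_le_one hK0]; nlinarith
  have i4 : A₁ * (1 / K ^ 2) * E₁ ≤ 1 := by
    rw [mul_one_div, div_mul_eq_mul_div, div_le_one (by positivity)]; nlinarith
  have b01 : |vortEntry (packet (prof r K)) y 0 1| ≤ 2 := by
    refine w01.trans ?_
    rw [one_mul, one_mul]
    linarith
  have b02 : |vortEntry (packet (prof r K)) y 0 2| ≤ 1 := w02.trans i3
  have b12 : |vortEntry (packet (prof r K)) y 1 2| ≤ 1 := w12.trans i4
  have hGd : Differentiable ℝ (background n etaZ) :=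
    (contDiff_background etaZ_contDiff).differentiable infty_ne_zero₈
  have hWd : Differentiable ℝ (packet (prof r K)) := (contDiff_packet hφ).differentiable infty_ne_zero₈
  exact eVortSq_add_sub_le (hGd y) (hWd y) g01 g02 g12 b01 b02 b12

end LogDoor

end Summit.NavierStokesRegularity.FunctionalMining

end
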